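import Mathlib
import Summits.Ventures.PercRepro2.TypedBlockSurgery

/-!
# The fibre of a block (blind cell PercRepro2, mine-2 g37, 2026-08-28; `proofs/MINE2-FIBRE.md` §1b)

The data of a block `W` on a fibre (`BlockData`: the forced-open configuration `z` closed on the split
set, the roots outside `W`, no vertex of `W` attached to a root through `z`, every edge of the fibre
graph leaving `W` attached to a root), the `W`-blind and `W`-side functions, and the consequences of
`Q` on a copy of the fibre: the attachment hypothesis of the block surgery holds with base
`closeAtW W z` (`BlockData.attached`) and the side of a vertex of `W` is read off the open edges
leaving `W` (`BlockData.conn_side_iff`).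

Own code; standard axioms.
-/

namespace Summit.Ventures.PercRepro2

open UnionCluster

namespace CovForm

namespace BlockTransfer

section Fibre

open Classical

variable {V : Type*} {E : Type*} [Fintype E] [DecidableEq E] {R : Type*} [Field R]
variable (ends : E → Sym2 V) (a₁ a₂ : V) (W : Finset V)

/-- The data of a block on a fibre: `z` closed on the split set, the roots outside `W`, no vertex of
`W` attached to a root through `z`, every edge of the fibre graph leaving `W` attached to a root. -/
structure BlockData (S : Finset E) (z : Config E) : Prop where
  zS : ∀ e ∈ S, z e = false
  a₁W : a₁ ∉ W
  a₂W : a₂ ∉ W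
  notAtt : ∀ v ∈ W, ¬ Conn ends z v a₁ ∧ ¬ Conn ends z v a₂
  leave : ∀ e, (e ∈ S ∨ z e = true) → ∀ x y, ends e = s(x, y) → x ∈ W → y ∉ W →
    Conn ends z y a₁ ∨ Conn ends z y a₂

/-- A function of configurations seeing only the connectivity outside `W`. -/
def WBlind (X : Config E → R) : Prop :=
  ∀ ω ω' : Config E, (∀ u v, u ∉ W → v ∉ W → (Conn ends ω u v ↔ Conn ends ω' u v)) → X ω = X ω'

/-- A function of configurations seeing only the sides of the vertices of `W`. -/
def WSide (Y : Config E → R) : Prop :=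
  ∀ ω ω' : Config E, (∀ v ∈ W, (Conn ends ω a₁ v ↔ Conn ends ω' a₁ v) ∧
    (Conn ends ω a₂ v ↔ Conn ends ω' a₂ v)) → Y ω = Y ω'

/-- The split edges touching `W`. -/
noncomputable def splitTouch (S : Finset E) : Finset E := S.filter (fun e => touchesW ends W e)

/-- The block covariance kernel. -/
noncomputable def covW (X Y : Config E → R) (y w : Config E) : R :=
  iQ ends a₁ a₂ y * iQ ends a₁ a₂ w * (X w - X y) * (Y w - Y y)

variable {ends a₁ a₂ W}

omit [Fintype E] [DecidableEq E] in
/-- Membership in the split edges touching `W`. -/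
lemma mem_splitTouch {S : Finset E} {e : E} : e ∈ splitTouch ends W S ↔ e ∈ S ∧ touchesW ends W e := by
  simp [splitTouch]

omit [Fintype E] [DecidableEq E] in
/-- `1_{v ∈ C(a)}` is `W`-blind for `a, v ∉ W`. -/
lemma wblind_iL {a v : V} (ha : a ∉ W) (hv : v ∉ W) : WBlind ends W (iL ends a v : Config E → R) := by
  intro ω ω' h
  simp only [iL, Set.indicator_apply, mem_connEvent, Pi.one_apply, h a v ha hv]

omit [Fintype E] [DecidableEq E] in
/-- `1_{v ∈ C(a)}` (second root) is `W`-blind for `a, v ∉ W`. -/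
lemma wblind_iH {a v : V} (ha : a ∉ W) (hv : v ∉ W) : WBlind ends W (iH ends a v : Config E → R) := by
  intro ω ω' h
  simp only [iH, Set.indicator_apply, mem_connEvent, Pi.one_apply, h a v ha hv]

omit [Fintype E] [DecidableEq E] in
/-- Differences of `W`-blind functions are `W`-blind. -/
lemma wblind_sub {X Y : Config E → R} (hX : WBlind ends W X) (hY : WBlind ends W Y) :
    WBlind ends W (fun ω => X ω - Y ω) := fun ω ω' h => by simp only [hX ω ω' h, hY ω ω' h]

omit [Fintype E] [DecidableEq E] in
/-- Sums of `W`-blind functions are `W`-blind. -/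
lemma wblind_add {X Y : Config E → R} (hX : WBlind ends W X) (hY : WBlind ends W Y) :
    WBlind ends W (fun ω => X ω + Y ω) := fun ω ω' h => by simp only [hX ω ω' h, hY ω ω' h]

omit [Fintype E] [DecidableEq E] in
/-- Products of `W`-blind functions are `W`-blind. -/
lemma wblind_mul {X Y : Config E → R} (hX : WBlind ends W X) (hY : WBlind ends W Y) :
    WBlind ends W (fun ω => X ω * Y ω) := fun ω ω' h => by simp only [hX ω ω' h, hY ω ω' h]

omit [Fintype E] [DecidableEq E] in
/-- The side sign of a mark `v ∉ W` is `W`-blind (roots outside `W`). -/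
lemma wblind_sigma {v : V} (h1 : a₁ ∉ W) (h2 : a₂ ∉ W) (hv : v ∉ W) :
    WBlind ends W (sigma ends a₁ a₂ v : Config E → R) :=
  wblind_sub (wblind_iL h1 hv) (wblind_iH h2 hv)

omit [Fintype E] [DecidableEq E] in
/-- `1_{v ∈ U}` of a mark `v ∉ W` is `W`-blind (roots outside `W`). -/
lemma wblind_inU {v : V} (h1 : a₁ ∉ W) (h2 : a₂ ∉ W) (hv : v ∉ W) :
    WBlind ends W (inU ends a₁ a₂ v : Config E → R) :=
  wblind_add (wblind_iL h1 hv) (wblind_iH h2 hv)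

omit [Fintype E] [DecidableEq E] in
/-- `1_{v ∈ C(a₁)}` is `W`-side for `v ∈ W`. -/
lemma wside_iL {v : V} (hv : v ∈ W) : WSide ends a₁ a₂ W (iL ends a₁ v : Config E → R) := by
  intro ω ω' h
  simp only [iL, Set.indicator_apply, mem_connEvent, Pi.one_apply, (h v hv).1]

omit [Fintype E] [DecidableEq E] in
/-- `1_{v ∈ C(a₂)}` is `W`-side for `v ∈ W`. -/
lemma wside_iH {v : V} (hv : v ∈ W) : WSide ends a₁ a₂ W (iH ends a₂ v : Config E → R) := by
  intro ω ω' h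
  simp only [iH, Set.indicator_apply, mem_connEvent, Pi.one_apply, (h v hv).2]

omit [Fintype E] [DecidableEq E] in
/-- Differences of `W`-side functions are `W`-side. -/
lemma wside_sub {X Y : Config E → R} (hX : WSide ends a₁ a₂ W X) (hY : WSide ends a₁ a₂ W Y) :
    WSide ends a₁ a₂ W (fun ω => X ω - Y ω) := fun ω ω' h => by simp only [hX ω ω' h, hY ω ω' h]

omit [Fintype E] [DecidableEq E] in
/-- Sums of `W`-side functions are `W`-side. -/
lemma wside_add {X Y : Config E → R} (hX : WSide ends a₁ a₂ W X) (hY : WSide ends a₁ a₂ W Y) :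
    WSide ends a₁ a₂ W (fun ω => X ω + Y ω) := fun ω ω' h => by simp only [hX ω ω' h, hY ω ω' h]

omit [Fintype E] [DecidableEq E] in
/-- Products of `W`-side functions are `W`-side. -/
lemma wside_mul {X Y : Config E → R} (hX : WSide ends a₁ a₂ W X) (hY : WSide ends a₁ a₂ W Y) :
    WSide ends a₁ a₂ W (fun ω => X ω * Y ω) := fun ω ω' h => by simp only [hX ω ω' h, hY ω ω' h]

omit [Fintype E] [DecidableEq E] in
/-- The side sign of a vertex of `W` is `W`-side. -/
lemma wside_sigma {v : V} (hv : v ∈ W) : WSide ends a₁ a₂ W (sigma ends a₁ a₂ v : Config E → R) :=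
  wside_sub (wside_iL hv) (wside_iH hv)

omit [Fintype E] [DecidableEq E] in
/-- `1_{v ∈ U}` of a vertex of `W` is `W`-side. -/
lemma wside_inU {v : V} (hv : v ∈ W) : WSide ends a₁ a₂ W (inU ends a₁ a₂ v : Config E → R) :=
  wside_add (wside_iL hv) (wside_iH hv)

/-! ## The fibre -/

omit [Fintype E] [DecidableEq E] in
/-- The forced-open configuration lies below every copy of the fibre. -/
lemma BlockData.le {S : Finset E} {z : Config E} (hd : BlockData ends a₁ a₂ W S z) (ω : Config E)
    (hω : ∀ e, e ∉ S → ω e = z e) : z ≤ ω := by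
  intro e
  by_cases hS : e ∈ S
  · rw [hd.zS e hS]; exact Bool.false_le _
  · rw [hω e hS]

omit [Fintype E] [DecidableEq E] in
/-- A vertex attached to a root through `z` is attached by a path avoiding the block. -/
lemma BlockData.conn_root_off {S : Finset E} {z : Config E} (hd : BlockData ends a₁ a₂ W S z)
    {y r : V} (hr : r = a₁ ∨ r = a₂) (h : Conn ends z y r) : Conn ends (closeAtW ends W z) y r := by
  have hyW : y ∉ W := fun hy => by
    rcases hr with rfl | rfl
    · exact (hd.notAtt y hy).1 h
    · exact (hd.notAtt y hy).2 h
  let T : Set V := {v | v ∉ W ∧ Conn ends (closeAtW ends W z) y v}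
  have hT : ∀ x ∈ T, ∀ v, (openGraph ends z).Adj x v → v ∈ T := by
    intro x hx v hxv
    rw [openGraph_adj] at hxv
    obtain ⟨-, e, he, hends⟩ := hxv
    obtain ⟨hxW, hcx⟩ := hx
    by_cases hvW : v ∈ W
    · exfalso
      have hcv : Conn ends z v y := conn_trans (conn_symm (conn_of_openAdj ⟨e, he, hends⟩))
        (conn_symm (conn_mono (closeAtW_le ends W z) hcx))
      rcases hr with rfl | rfl
      · exact (hd.notAtt v hvW).1 (conn_trans hcv h)
      · exact (hd.notAtt v hvW).2 (conn_trans hcv h)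
    · refine ⟨hvW, ?_⟩
      have hnt : ¬ touchesW ends W e := not_touchesW ends W hends hxW hvW
      have he₀ : closeAtW ends W z e = true := by rw [closeAtW_of_not ends W hnt]; exact he
      exact conn_trans hcx (conn_of_openAdj ⟨e, he₀, hends⟩)
  have hmem := mem_of_conn_of_closed hT ⟨hyW, conn_refl ends _ y⟩ h
  exact hmem.2

omit [Fintype E] [DecidableEq E] in
/-- An open edge of a copy of the fibre is a split edge or forced open. -/
lemma BlockData.open_mem {S : Finset E} {z : Config E} (_hd : BlockData ends a₁ a₂ W S z)
    (ω : Config E) (hω : ∀ e, e ∉ S → ω e = z e) {e : E} (he : ω e = true) : e ∈ S ∨ z e = true := by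
  by_cases hS : e ∈ S
  · exact Or.inl hS
  · right; rw [← hω e hS]; exact he

omit [Fintype E] [DecidableEq E] in
/-- With `Q`, a copy of the fibre satisfies the attachment hypothesis with base `closeAtW W z`. -/
lemma BlockData.attached {S : Finset E} {z : Config E} (hd : BlockData ends a₁ a₂ W S z)
    (ω : Config E) (hω : ∀ e, e ∉ S → ω e = z e) (hQ : ¬ Conn ends ω a₂ a₁) :
    Attached ends W ω (closeAtW ends W z) := by
  intro e e' he he' x z₁ x' z' hends hends' hxW hz₁W hx'W hz'W hxx'
  have hzω : z ≤ ω := hd.le ω hω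
  have hwin : withinW ends W ω ≤ ω := by intro e''; unfold withinW; split_ifs <;> simp
  have h1 := hd.leave e (hd.open_mem ω hω he) x z₁ hends hxW hz₁W
  have h2 := hd.leave e' (hd.open_mem ω hω he') x' z' hends' hx'W hz'W
  -- the chain `z₁ ~ x ~ x' ~ z'` in `ω`
  have hchain : Conn ends ω z₁ z' :=
    conn_trans (conn_symm (conn_of_openAdj ⟨e, he, hends⟩))
      (conn_trans (conn_mono hwin hxx') (conn_of_openAdj ⟨e', he', hends'⟩))
  rcases h1 with h1 | h1 <;> rcases h2 with h2 | h2
  · exact conn_trans (hd.conn_root_off (Or.inl rfl) h1) (conn_symm (hd.conn_root_off (Or.inl rfl) h2))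
  · exfalso
    exact hQ (conn_trans (conn_symm (conn_mono hzω h2)) (conn_trans (conn_symm hchain)
      (conn_mono hzω h1)))
  · exfalso
    exact hQ (conn_trans (conn_symm (conn_mono hzω h1)) (conn_trans hchain (conn_mono hzω h2)))
  · exact conn_trans (hd.conn_root_off (Or.inr rfl) h1) (conn_symm (hd.conn_root_off (Or.inr rfl) h2))

omit [Fintype E] [DecidableEq E] in
/-- The base lies below the block-closed copy. -/
lemma BlockData.base_le {S : Finset E} {z : Config E} (hd : BlockData ends a₁ a₂ W S z)
    (ω : Config E) (hω : ∀ e, e ∉ S → ω e = z e) : closeAtW ends W z ≤ closeAtW ends W ω :=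
  closeAtW_mono ends W (hd.le ω hω)

omit [Fintype E] [DecidableEq E] in
/-- With `Q`, the side of a vertex of `W` is read off the open edges leaving `W` and the internal
paths: `r ↔ v` iff some open edge leaving `W` from a vertex internally joined to `v` has its outer end
attached to `r` through `z`. -/
lemma BlockData.conn_side_iff {S : Finset E} {z : Config E} (hd : BlockData ends a₁ a₂ W S z)
    (ω : Config E) (hω : ∀ e, e ∉ S → ω e = z e) (hQ : ¬ Conn ends ω a₂ a₁) {r : V}
    (hr : r = a₁ ∨ r = a₂) {v : V} (hv : v ∈ W) :
    Conn ends ω r v ↔ ∃ x ∈ W, Conn ends (withinW ends W ω) x v ∧ ∃ e, ω e = true ∧ ∃ z₁, z₁ ∉ W ∧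
      ends e = s(x, z₁) ∧ Conn ends z z₁ r := by
  have hrW : r ∉ W := by rcases hr with rfl | rfl; exact hd.a₁W; exact hd.a₂W
  have hzω : z ≤ ω := hd.le ω hω
  constructor
  · intro h
    obtain ⟨x, hxW, hxv, e, he, z₁, hz₁W, hends, hrz⟩ := conn_mem_imp ends W ω _ (hd.base_le ω hω)
      (hd.attached ω hω hQ) hrW hv h
    refine ⟨x, hxW, hxv, e, he, z₁, hz₁W, hends, ?_⟩
    have hrz' : Conn ends ω r z₁ := conn_mono (closeAtW_le ends W ω) hrz
    rcases hd.leave e (hd.open_mem ω hω he) x z₁ hends hxW hz₁W with h1 | h1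
    · rcases hr with rfl | rfl
      · exact h1
      · exfalso; exact hQ (conn_trans hrz' (conn_mono hzω h1))
    · rcases hr with rfl | rfl
      · exfalso; exact hQ (conn_trans (conn_symm (conn_mono hzω h1)) (conn_symm hrz'))
      · exact h1
  · rintro ⟨x, hxW, hxv, e, he, z₁, hz₁W, hends, hz₁⟩
    exact conn_of_entry ends W ω he hends hxv (conn_symm (conn_mono (hd.base_le ω hω)
      (hd.conn_root_off hr hz₁)))

end Fibre

end BlockTransfer

end CovForm

end Summit.Ventures.PercRepro2
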